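import Literature.MathematicalPhysics.QuantumLattice.FermionGammaFunctorTrace
import Literature.MathematicalPhysics.QuantumLattice.BdGBondHamiltonianParticleHole
import HarnessLib

/-!
# The Trotter determinant formula for BdG Hamiltonians with time-dependent bond data

Topic `Literature/MathematicalPhysics/QuantumLattice` (family `hubbard`), in the story of
`BdGBondHamiltonian(ParticleHole).lean`. For the tree's lattice Bogoliubov–de Gennes Hamiltonian
`bdgBondHamiltonian τ Δ μ` with ARBITRARY bond data and any finite orbital set `Λ`, and for any
SLICE-DEPENDENT data `τ_t, Δ_t` (`t < M`) — a Trotterised space–time pair-phase / gauge-field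
configuration — we prove

* **`trace_prod_gibbsWeight_bdgBondHamiltonian`**:
  `Tr ∏_t e^{-a H_BdG(τ_t, Δ_t, μ)} = e^{-a Σ_t Σ_x (τ_t(x,x) - μ)} · det(1 + ∏_t e^{-a 𝓗(τ_t, Δ_t, μ)})`,
  `𝓗 = bdgNambuMatrix τ_t Δ_t μ` the (particle-number conserving) Nambu matrix on `Orb Λ`:
  the Fock-space weight of the configuration is a `2|Λ| × 2|Λ|` determinant;
* `star_trace_prod_map_gibbsWeight(_bdgBondHamiltonian)`,
  `star_det_one_add_prod_map_gibbsWeight(_bdgNambuMatrix)` — **time-reflection reality**: for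
  Hermitian slice data complex conjugation REVERSES the time order of the Trotter product
  (`conj W(θ₁,…,θ_M) = W(θ_M,…,θ₁)`; Osterwalder–Schrader Hermiticity of the induced weight, using
  only Hermiticity of each slice generator).

Proof: Lieb's partial particle–hole transformation slice by slice
(`partialParticleHole_conj_bdgBondHamiltonian`: `W H_BdG Wᴴ = dΓ(𝓗) + C·1` with the SAME unitary
`W` for all data), telescoping of `W` through the product, and the product trace formula
`trace_prod_ofFn_gibbsWeight_dGamma` (`Tr ∏ e^{-a dΓ(𝓗_t)} = det(1 + ∏ e^{-a𝓗_t})`,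
`FermionGammaFunctorTrace`). No Hermiticity of `τ_t` is needed. The `M = 1`, Hermitian case is the
tree's `partitionFn_bdgBondHamiltonian`. This is the determinant by which a fermionic
(BCS/BdG-reference) weight of a phase history is computed in practice (auxiliary-field /
determinant QMC: Blankenbecler–Scalapino–Sugar 1981), here for the pairing channel via the
particle–hole device of Bach–Lieb–Solovej 1994 §2.

## Mathlib / tree search

Tree (REUSED): `bdgBondHamiltonian`, `bdgNambuMatrix`, `partialParticleHole`, `spinDownOrbitals`,
`partialParticleHole_conj_bdgBondHamiltonian`, `partialParticleHole_mul_conjTranspose`,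
`partialParticleHole_conjTranspose_mul`, `gibbsWeight_add_smul_one` (`BdGBondHamiltonianParticleHole`);
`trace_prod_ofFn_gibbsWeight_dGamma` (`FermionGammaFunctorTrace`); `Matrix.gibbsWeight`.
Mathlib: `Matrix.exp_conj'`, `Matrix.inv_eq_left_inv`, `Matrix.trace_mul_cycle`, `Complex.exp_sum`.

## References

* V. Bach, E. H. Lieb, J. P. Solovej, J. Stat. Phys. 76 (1994) 3, §2. [BachLiebSolovej1994]
* J. Dereziński, C. Gérard, *Mathematics of Quantization and Quantum Fields* (2022), §17.2.4
  (`Tr Γ(γ) = det(𝟙 + γ)`). [DerezinskiGerard2022]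
* R. Blankenbecler, D. J. Scalapino, R. L. Sugar, *Monte Carlo calculations of coupled
  boson-fermion systems. I*, Phys. Rev. D 24 (1981) 2278 (the Trotter determinant). [folklore]
-/

noncomputable section

namespace Literature.MathematicalPhysics.QuantumLattice

open Matrix Finset NormedSpace

/-! ### The Trotter determinant formula for BdG (pairing) Hamiltonians -/

section TrotterDeterminant

variable {Λ : Type*} [LinearOrder Λ] [Fintype Λ]

/-- Conjugating every factor of a list product by a two-sided inverse pair telescopes. [folklore] -/
theorem prod_map_conj_of_mul_eq_one {n : Type*} [Fintype n] [DecidableEq n] {U V : Matrix n n ℂ}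
    (hUV : U * V = 1) (hVU : V * U = 1) :
    ∀ l : List (Matrix n n ℂ), (l.map fun X => U * X * V).prod = U * l.prod * V
  | [] => by rw [List.map_nil, List.prod_nil, Matrix.mul_one, hUV]
  | X :: l => by
    rw [List.map_cons, List.prod_cons, List.prod_cons, prod_map_conj_of_mul_eq_one hUV hVU l]
    simp only [Matrix.mul_assoc]
    rw [← Matrix.mul_assoc V U, hVU, Matrix.one_mul]

/-- Scalars pull out of an `ofFn` product: `∏_t (c_t • G_t) = (∏_t c_t) • ∏_t G_t` (a private copy of
the tree's `prod_ofFn_smul` of `SpinChainsAkltCorrelationProofs`, not imported here). [folklore] -/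
private theorem prod_ofFn_const_smul {n : Type*} [Fintype n] [DecidableEq n] :
    ∀ {M : ℕ} (c : Fin M → ℂ) (G : Fin M → Matrix n n ℂ),
      (List.ofFn fun t => c t • G t).prod = (∏ t, c t) • (List.ofFn G).prod
  | 0, c, G => by simp
  | M + 1, c, G => by
    rw [List.ofFn_succ, List.prod_cons, prod_ofFn_const_smul (fun i => c i.succ) (fun i => G i.succ),
      List.ofFn_succ, List.prod_cons, Fin.prod_univ_succ, Matrix.smul_mul, Matrix.mul_smul, smul_smul,
      mul_comm (c 0)]

/-- The Gibbs weight of a conjugate by the (unitary) partial particle–hole transformation is the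
conjugate of the Gibbs weight. [folklore] -/
theorem gibbsWeight_ph_conj (a : ℝ) (X : Matrix (Finset (Orb Λ)) (Finset (Orb Λ)) ℂ) :
    Matrix.gibbsWeight a ((partialParticleHole (spinDownOrbitals : Finset (Orb Λ)))ᴴ * X *
        partialParticleHole (spinDownOrbitals : Finset (Orb Λ))) =
      (partialParticleHole (spinDownOrbitals : Finset (Orb Λ)))ᴴ * Matrix.gibbsWeight a X *
        partialParticleHole (spinDownOrbitals : Finset (Orb Λ)) := by
  set W := partialParticleHole (spinDownOrbitals : Finset (Orb Λ))
  have hW' : Wᴴ * W = 1 := partialParticleHole_conjTranspose_mul _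
  have hinv : W⁻¹ = Wᴴ := Matrix.inv_eq_left_inv hW'
  have hunit : IsUnit W := (Matrix.isUnit_iff_isUnit_det W).mpr
    (Matrix.isUnit_det_of_left_inverse hW')
  rw [Matrix.gibbsWeight, Matrix.gibbsWeight, ← hinv,
    show -(a : ℂ) • (W⁻¹ * X * W) = W⁻¹ * (-(a : ℂ) • X) * W by rw [Matrix.mul_smul, Matrix.smul_mul],
    Matrix.exp_conj' _ _ hunit]

/-- **Trotter determinant formula for BdG weights.** For ANY finite orbital set, any slice-dependent
hopping data `τ_t` and pairing data `Δ_t` (`t < M`: e.g. a space–time pair-phase / gauge-field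
configuration), chemical potential `μ` and step `a`,
`Tr ∏_t e^{-a H_BdG(τ_t, Δ_t, μ)} = e^{-a Σ_t Σ_x (τ_t(x,x) - μ)} · det(1 + ∏_t e^{-a 𝓗(τ_t, Δ_t, μ)})`
with the Nambu matrices `𝓗 = bdgNambuMatrix τ_t Δ_t μ` — the fermionic weight of a Trotterised
configuration of (inhomogeneous, time-dependent) BdG data is a `2|Λ| × 2|Λ|` determinant. Proof:
Lieb's partial particle–hole transformation (`partialParticleHole_conj_bdgBondHamiltonian`,
`W H Wᴴ = dΓ(𝓗) + C·1`) slice by slice, telescoping of `W`, and the product trace formula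
`trace_prod_ofFn_gibbsWeight_dGamma`. The `M = 1` Hermitian case is the tree's
`partitionFn_bdgBondHamiltonian`. Bach–Lieb–Solovej 1994 §2 (reduction); Dereziński–Gérard §17.2.4
(`Tr Γ(γ) = det(1+γ)`); this Trotter/transfer-matrix form is the determinant behind auxiliary-field
QMC (Blankenbecler–Scalapino–Sugar 1981). [cite: DerezinskiGerard2022, §17.2.4] -/
theorem trace_prod_gibbsWeight_bdgBondHamiltonian {M : ℕ} (τ Δ : Fin M → Λ → Λ → ℂ) (μ a : ℝ) :
    ((List.ofFn fun t => Matrix.gibbsWeight a (bdgBondHamiltonian (τ t) (Δ t) μ)).prod).trace =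
      Complex.exp (-(a : ℂ) * ∑ t, ∑ x, (τ t x x - μ)) *
        (1 + (List.ofFn fun t => Matrix.gibbsWeight a (bdgNambuMatrix (τ t) (Δ t) μ)).prod).det := by
  set W := partialParticleHole (spinDownOrbitals : Finset (Orb Λ)) with hWdef
  have hW : W * Wᴴ = 1 := partialParticleHole_mul_conjTranspose _
  have hW' : Wᴴ * W = 1 := partialParticleHole_conjTranspose_mul _
  -- each factor
  have hfac : ∀ t, Matrix.gibbsWeight a (bdgBondHamiltonian (τ t) (Δ t) μ) =
      Wᴴ * (Complex.exp (-(a : ℂ) * ∑ x, (τ t x x - μ)) •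
        Matrix.gibbsWeight a (dGamma (bdgNambuMatrix (τ t) (Δ t) μ))) * W := by
    intro t
    have h := partialParticleHole_conj_bdgBondHamiltonian (τ t) (Δ t) μ
    have hH : bdgBondHamiltonian (τ t) (Δ t) μ = Wᴴ * (dGamma (bdgNambuMatrix (τ t) (Δ t) μ) +
        (∑ x : Λ, (τ t x x - μ)) • (1 : Matrix (Finset (Orb Λ)) (Finset (Orb Λ)) ℂ)) * W := by
      rw [← h]
      simp only [Matrix.mul_assoc]
      rw [hW', Matrix.mul_one, ← Matrix.mul_assoc, hW', Matrix.one_mul]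
    rw [hH, hWdef, gibbsWeight_ph_conj, gibbsWeight_add_smul_one]
  have hlist : (List.ofFn fun t => Matrix.gibbsWeight a (bdgBondHamiltonian (τ t) (Δ t) μ)) =
      (List.ofFn fun t => Complex.exp (-(a : ℂ) * ∑ x, (τ t x x - μ)) •
        Matrix.gibbsWeight a (dGamma (bdgNambuMatrix (τ t) (Δ t) μ))).map fun X => Wᴴ * X * W := by
    rw [List.map_ofFn]
    exact congrArg List.ofFn (funext hfac)
  rw [hlist, prod_map_conj_of_mul_eq_one hW' hW, prod_ofFn_const_smul, Matrix.mul_smul, Matrix.smul_mul,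
    trace_smul, trace_mul_cycle, hW, Matrix.one_mul, trace_prod_ofFn_gibbsWeight_dGamma, smul_eq_mul,
    ← Complex.exp_sum, ← Finset.mul_sum]


/-! ### Time-reflection reality of Trotter weights (Osterwalder–Schrader Hermiticity) -/

/-- **Time-reflection reality**, generic form: for a list of HERMITIAN matrices `H_1, …, H_M`,
`conj Tr (e^{-aH_1} ⋯ e^{-aH_M}) = Tr (e^{-aH_M} ⋯ e^{-aH_1})` — complex conjugation reverses the
time order of an imaginary-time transfer product (only Hermiticity of each slice generator is
used, no time-reversal symmetry). [folklore] -/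
theorem star_trace_prod_map_gibbsWeight {n : Type*} [Fintype n] [DecidableEq n] (a : ℝ)
    (l : List (Matrix n n ℂ)) (hl : ∀ H ∈ l, H.IsHermitian) :
    star ((l.map (Matrix.gibbsWeight a)).prod.trace) =
      ((l.reverse.map (Matrix.gibbsWeight a)).prod).trace := by
  rw [← trace_conjTranspose, conjTranspose_list_prod, List.map_map, ← List.map_reverse]
  congr 2
  refine List.map_congr_left fun H hH => ?_
  exact isHermitian_gibbsWeight a (hl H (List.mem_reverse.mp hH))

/-- **Time-reflection reality of the Trotter determinant**: for Hermitian `H_t`,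
`conj det(1 + e^{-aH_1} ⋯ e^{-aH_M}) = det(1 + e^{-aH_M} ⋯ e^{-aH_1})`. [folklore] -/
theorem star_det_one_add_prod_map_gibbsWeight {n : Type*} [Fintype n] [DecidableEq n] (a : ℝ)
    (l : List (Matrix n n ℂ)) (hl : ∀ H ∈ l, H.IsHermitian) :
    star ((1 + (l.map (Matrix.gibbsWeight a)).prod).det) =
      (1 + (l.reverse.map (Matrix.gibbsWeight a)).prod).det := by
  rw [← det_conjTranspose, conjTranspose_add, conjTranspose_one, conjTranspose_list_prod,
    List.map_map, ← List.map_reverse]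
  congr 3
  refine List.map_congr_left fun H hH => ?_
  exact isHermitian_gibbsWeight a (hl H (List.mem_reverse.mp hH))

/-- **Time-reflection reality of the fermionic weight of a BdG history** (Fock level): for
Hermitian hopping data, `conj Tr ∏_t e^{-aH_BdG(τ_t,Δ_t,μ)}` is the same trace with the slices in
REVERSED order — hypothesis (R) / Osterwalder–Schrader Hermiticity of the induced phase action holds
for every pairing texture, per chiral sector. [folklore] -/
theorem star_trace_prod_map_gibbsWeight_bdgBondHamiltonian (a μ : ℝ)
    (l : List ((Λ → Λ → ℂ) × (Λ → Λ → ℂ))) (hl : ∀ p ∈ l, ∀ x y, star (p.1 x y) = p.1 y x) :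
    star ((l.map fun p => Matrix.gibbsWeight a (bdgBondHamiltonian p.1 p.2 μ)).prod.trace) =
      ((l.reverse.map fun p => Matrix.gibbsWeight a (bdgBondHamiltonian p.1 p.2 μ)).prod).trace := by
  have h := star_trace_prod_map_gibbsWeight a (l.map fun p => bdgBondHamiltonian p.1 p.2 μ)
    (fun H hH => by
      obtain ⟨p, hp, rfl⟩ := List.mem_map.mp hH
      exact isHermitian_bdgBondHamiltonian (hl p hp) p.2 μ)
  rwa [List.map_map, ← List.map_reverse, List.map_map] at h

/-- **Time-reflection reality of the BdG Trotter determinant**: for Hermitian hopping data,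
`conj det(1 + ∏_t e^{-a𝓗(τ_t,Δ_t,μ)}) = det(1 + ∏_{t reversed} e^{-a𝓗(τ_t,Δ_t,μ)})`. [folklore] -/
theorem star_det_one_add_prod_map_gibbsWeight_bdgNambuMatrix (a μ : ℝ)
    (l : List ((Λ → Λ → ℂ) × (Λ → Λ → ℂ))) (hl : ∀ p ∈ l, ∀ x y, star (p.1 x y) = p.1 y x) :
    star ((1 + (l.map fun p => Matrix.gibbsWeight a (bdgNambuMatrix p.1 p.2 μ)).prod).det) =
      (1 + (l.reverse.map fun p => Matrix.gibbsWeight a (bdgNambuMatrix p.1 p.2 μ)).prod).det := by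
  have h := star_det_one_add_prod_map_gibbsWeight a (l.map fun p => bdgNambuMatrix p.1 p.2 μ)
    (fun H hH => by
      obtain ⟨p, hp, rfl⟩ := List.mem_map.mp hH
      exact isHermitian_bdgNambuMatrix (hl p hp) p.2 μ)
  rwa [List.map_map, ← List.map_reverse, List.map_map] at h

end TrotterDeterminant

end Literature.MathematicalPhysics.QuantumLattice
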